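import Summits.QuantumFields.YangMills.Theorems.FirstExitWindowFirstExitWindowTailLFirstExitOne
import Literature.MathematicalPhysics.QuantumFieldTheory.Balaban1983to89.T3InteriorExcision
import Literature.MathematicalPhysics.QuantumFieldTheory.Balaban1983to89.T3SmallLiftHistory
import HarnessLib

/-!
# RUNG «depth-blame» — the `j`-fold averaged-plaquette tail at EVERY depth with a GEOMETRIC rate, PROVED
# (helper for the PATH-B row `FirstExitWindow.FirstExitWindowTailL`, stmt-QuantumFields-26243; `--supports`, not a registered stub)

Seat `ym3-torus-px17` g10 (width copy of `ym3-torus-p1`), on the ideator `ym-r3-idea-2` g18 plan card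
`Cruxes/HistoryTailL/RungDepthBlame.md` (statement VERBATIM from `Cruxes/HistoryTailL/RungDepthBlame.lean`, `stub_depthRateTail`).

THE CLAIM ★★★ `depthRateTail`: for every block size `L` and profile ceiling `(b₀, p₀)` (`b₀ > 0`, `p₀ > 2`) there are `γ₁ ∈ (0,1]`,
`C ≥ 0`, `c > 0`, a RATE `0 < λ ≤ 1` and a power `N` such that for every d = 3 family `F` with `F.L = L`, every `0 < γ ≤ γ₁`, every
cut-off `K`, EVERY depth `j ≤ K`, every threshold profile `0 < b ≤ b₀` and every level-`j` plaquette `p`: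
`Gibbs_K{ θ_b(K−j) ≤ |Ū^j(∂p) − 1| } ≤ C^(j+1) · β_(K−j)^N · exp(−c · λ^(2j) · p_b(g_(K−j))²)`,
`β_h = (γL^(−h))⁻¹ = g_h⁻²`, `θ_b(h) = g_h·p_b(g_h)`, `p_b = B10.pFun b p₀` — the BARE law of the `j`-fold (0.4)-average, no history
condition.  Witnesses: `N = 5`, `c = 1∕4`, `λ = √L ∕ W`, `W = L² + 6(5L)² + 1`, `C = (L² + 45L³)·(2e^24·c₀⁻³)·L^5` (`c₀` the Haar
small-ball constant of the bare tail), `γ₁` = the threshold below which `θ_(b₀)(i) ≤ δ_(SU(2))∕(5L)²` at every height.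

THE PROOF (induction on the depth `j` at fixed `F, γ, K`, the profile `b ≤ b₀` INSIDE the induction predicate; two landed engines):
* base `j = 0`: the tree's bare single-plaquette tail `T3FinestHeightTail.gibbsMeasure_real_dist1_ge_le` (`N := 2`) at `β_K`,
  `θ = θ_b(K)`: `β_K·θ_b(K)² = p_b(g_K)²`, `(√β_K)^9 ≤ β_K^5`;
* step `j → j+1` (`h = K − (j+1)`): the blamed neighbourhood `FirstExitWindow.exists_blame_finset` of `p` (`≤ L² + 45L³` level-`j` plaquettes,
  `Ū^(j+1) = avgFun ℰp (Ū^j)`): `θ_b(h) ≤ |Ū^(j+1)(∂p) − 1|` forces `θ_b(h)∕W ≤ |Ū^j(∂q) − 1|` for a blamed `q` (guard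
  `(5L)²∕4·θ_b(h)∕W < δ` uniformly from `γ ≤ γ₁`); the blamed threshold is RE-LABELLED as a profile threshold one height up,
  `θ_b(h)∕W = θ_(b′)(h+1)` with `b′ = κ·b`, `κ = θ_b(h)∕(W·θ_b(h+1)) ≤ 1` (`θ(h) ≤ √L·θ(h+1)`, `T3SmallLiftHistory.mul_θBal_le_θBal_succ`,
  and `√L ≤ W`), so the induction hypothesis at profile `b′ ≤ b₀` applies; the height arithmetic is EXACT: `β_(h+1) = L·β_h` and
  `p_(b′)(g_(h+1))² = (L∕W²)·p_b(g_h)² = λ²·p_b(g_h)²`; the union costs `L² + 45L³`, and `(L² + 45L³)·L^5 ≤ C` closes with `C^(j+2)`.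
★ `firstExitDeep_depthRate`: the registered deep event of 26243 (`stub_firstExitDeep`'s event) at the depth rate, by monotonicity.

HONEST FRAMING.  Helper theorems (`--supports stmt-QuantumFields-26243`); the rate `λ_L = √L∕W < 1` is GENUINELY geometric — this is the
near-miss of `stub_firstExitDeep` (same sentence with `λ ↦ 1`, `C^(j+1) ↦ C`), NOT a proof of it; nothing of Bałaban's renormalisation-group
estimates is asserted; `FirstExitWindowTailL` (26243), `HistoryTailL` (19936), PATH A ∕ PATH B and rung R3 (continuum SU(2) YM₃ on T³ — NOT
d = 4, NOT infinite volume, NOT a mass gap, NOT Clay) stay exactly as open as before.  No `def`, no named fact, no `sorry`.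

References: T. Bałaban, CMP **98** (1985) 17–51 [Balaban1985Averaging] (Prop. 1 (51) p.26, p.25); CMP **102** (1985) 255–275
[Balaban1985UV3] ((3)–(7) pp.256–257, (71) p.273); [FrohlichIsraelLiebSimon1978] Thm. 4.1 (engine of the bare tail).
-/

set_option autoImplicit false

noncomputable section

open MeasureTheory
open scoped BigOperators

namespace Summit.QuantumFields.YangMills.Theorems.FirstExitWindow

open Literature.MathematicalPhysics.QuantumFieldTheory.Balaban1983to89
open Literature.MathematicalPhysics.QuantumFieldTheory.Balaban1983to89.T3ContinuumYM3Torus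
open Literature.MathematicalPhysics.QuantumFieldTheory.Balaban1983to89.T3UnitScaleTilt
open Literature.MathematicalPhysics.QuantumFieldTheory.Balaban1983to89.T3UnitLawDensityEML (ℰp)
open Literature.MathematicalPhysics.QuantumFieldTheory.Balaban1983to89.ExpMeanLog (expMeanLogSU deltaSU deltaSU_pos)
open Literature.MathematicalPhysics.QuantumFieldTheory.Balaban1983to89.BlockAveraging (blockAvg avgFun)
open Literature.MathematicalPhysics.QuantumFieldTheory.Balaban1983to89.T3Thresholds (exists_gamma_forall_θBal_le)
open Literature.MathematicalPhysics.QuantumFieldTheory.Balaban1983to89.T3MinimiserStabilityReduction (θBal_pos)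
open Literature.MathematicalPhysics.QuantumFieldTheory.Balaban1983to89.T3FinestHeightTail (gibbsMeasure_real_dist1_ge_le)
open Literature.MathematicalPhysics.QuantumFieldTheory.Balaban1983to89.T3InteriorExcision (θBal_mul θBal_mul_le)
open Literature.MathematicalPhysics.QuantumFieldTheory.Balaban1983to89.T3SmallLiftHistory (mul_θBal_le_θBal_succ)

section T3

/-- Height arithmetic at distance `h` from the unit scale (`γ > 0`): `β_(h+1) = L·β_h` and `β_h·θ_b(h)² = p_b(g_h)²`, where
`β_h = (γL^(−h))⁻¹ = g_h⁻²`, `θ_b(h) = g_h·p_b(g_h)`. [cite: Balaban1985UV3, (3)-(7) pp.256-257] -/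
theorem beta_height_succ_and_sq (F : T3Family) {γ : ℝ} (hγ : 0 < γ) (b p₀ : ℝ) (h : ℕ) :
    (γ * ((F.L : ℝ)⁻¹) ^ (h + 1))⁻¹ = (F.L : ℝ) * (γ * ((F.L : ℝ)⁻¹) ^ h)⁻¹ ∧
      (γ * ((F.L : ℝ)⁻¹) ^ h)⁻¹ * θBal F.L γ b p₀ h ^ 2 = B10.pFun b p₀ (Real.sqrt (γ * ((F.L : ℝ)⁻¹) ^ h)) ^ 2 := by
  have hL : (0 : ℝ) < F.L := by exact_mod_cast lt_trans zero_lt_one F.hL.2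
  have hx : 0 < γ * ((F.L : ℝ)⁻¹) ^ h := mul_pos hγ (pow_pos (inv_pos.2 hL) h)
  refine ⟨?_, ?_⟩
  · rw [pow_succ, ← mul_assoc, mul_inv, inv_inv, mul_comm]
  · rw [θBal, mul_pow, Real.sq_sqrt hx.le]
    field_simp

/-- ★★★ **RUNG «depth-blame» — the `j`-fold averaged-plaquette tail at every depth with geometric rate `λ^(2j)`** (the statement of
`Cruxes/HistoryTailL/RungDepthBlame.lean`'s `stub_depthRateTail` VERBATIM, proved): for every `L`, `(b₀, p₀)` there are `γ₁ ∈ (0,1]`,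
`C ≥ 0`, `c > 0`, `0 < λ ≤ 1`, `N` with: for every family `F` (`F.L = L`), `0 < γ ≤ γ₁`, every `K`, every depth `j ≤ K`, every threshold
profile `0 < b ≤ b₀` and every level-`j` plaquette `p`, `Gibbs_K{θ_b(K−j) ≤ |Ū^j(∂p) − 1|} ≤ C^(j+1)·β_(K−j)^N·exp(−c·λ^(2j)·p_b(g_(K−j))²)`.
Proof: induction on `j` — base = the bare single-plaquette tail, step = the blamed neighbourhood of the (0.4) averaging + the profile
re-label `θ_b(h)∕W = θ_(κb)(h+1)`, `κ ≤ 1`, with exact height arithmetic `β_(h+1) = L·β_h`, `p_(κb)(g_(h+1))² = (L∕W²)·p_b(g_h)²`; witnesses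
`N = 5`, `c = 1∕4`, `λ = √L∕W`, `W = L² + 6(5L)² + 1`, `C = (L² + 45L³)·2e^24c₀⁻³·L^5`.
[cite: Balaban1985UV3, (7) p.257 and (71) p.273; Balaban1985Averaging, Prop. 1 (51) p.26] -/
theorem depthRateTail :
    ∀ (L : ℕ) (b₀ p₀ : ℝ), 0 < b₀ → 2 < p₀ → ∃ (γ₁ C c lam : ℝ) (N : ℕ), 0 < γ₁ ∧ γ₁ ≤ 1 ∧ 0 < c ∧ 0 ≤ C ∧ 0 < lam ∧ lam ≤ 1 ∧
      ∀ (F : T3Family) (γ : ℝ), F.L = L → 0 < γ → γ ≤ γ₁ → ∀ (K j : ℕ), j ≤ K → ∀ (b : ℝ), 0 < b → b ≤ b₀ →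
        ∀ p : Plaq (F.P K) j,
          (gibbsK F ℰp γ K).real {U | θBal F.L γ b p₀ (K - j) ≤
              GaugeGroup.dist1 (GaugeField.plaqHol
                (Averaging.iter (fun i => BlockAveraging.blockAvg (P := F.P K) (j := i) ℰp) j U) p)} ≤
            C ^ (j + 1) * ((γ * ((F.L : ℝ)⁻¹) ^ (K - j))⁻¹) ^ N *
              Real.exp (-(c * lam ^ (2 * j) * B10.pFun b p₀ (Real.sqrt (γ * ((F.L : ℝ)⁻¹) ^ (K - j))) ^ 2)) := by
  intro L b₀ p₀ hb₀ hp₀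
  -- the universal constant of the bare single-plaquette tail
  obtain ⟨c₀, hc₀, hc₀1, htail⟩ := gibbsMeasure_real_dist1_ge_le (N := 2)
  by_cases hL : 1 ≤ L
  swap
  · -- degenerate block size: no family has `F.L = L ≤ 0`
    refine ⟨1, 0, 1, 1, 0, one_pos, le_rfl, one_pos, le_rfl, one_pos, le_rfl, ?_⟩
    intro F γ hFL
    exact absurd (hFL ▸ le_of_lt F.hL.2) hL
  -- the constants
  have hL0 : (0 : ℝ) < L := by exact_mod_cast (by omega : 0 < L)
  have hL1 : (1 : ℝ) ≤ L := by exact_mod_cast hL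
  set W : ℝ := (L : ℝ) ^ 2 + 6 * (((3 + 2) * L : ℕ) : ℝ) ^ 2 + 1 with hW
  have hLW : (L : ℝ) ≤ W := by
    have : (0 : ℝ) ≤ 6 * (((3 + 2) * L : ℕ) : ℝ) ^ 2 := by positivity
    nlinarith
  have hW1 : 1 ≤ W := hL1.trans hLW
  have hW0 : 0 < W := one_pos.trans_le hW1
  have hsqrtL : Real.sqrt (L : ℝ) ≤ (L : ℝ) := by
    calc Real.sqrt (L : ℝ) ≤ Real.sqrt ((L : ℝ) ^ 2) := Real.sqrt_le_sqrt (by nlinarith)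
      _ = (L : ℝ) := Real.sqrt_sq hL0.le
  have hsqrtL0 : 0 < Real.sqrt (L : ℝ) := Real.sqrt_pos.2 hL0
  have h5 : (0 : ℝ) < (((3 + 2) * L : ℕ) : ℝ) := by exact_mod_cast (by omega : 0 < (3 + 2) * L)
  have hσ : 0 < deltaSU (Fin 2) / (((3 + 2) * L : ℕ) : ℝ) ^ 2 := div_pos deltaSU_pos (by positivity)
  obtain ⟨γθ, hγθ, hγθ1, hθ⟩ := exists_gamma_forall_θBal_le hb₀ (by linarith : (0 : ℝ) < p₀) hσ
  -- `A` = the bare tail's constant, `B` = the blamed count, `C = B·A·L^5`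
  set A : ℝ := 2 * Real.exp 24 * (c₀ ^ 3)⁻¹ with hA
  have hA1 : 1 ≤ A := by
    have h1 : 1 ≤ (c₀ ^ 3)⁻¹ := (one_le_inv₀ (pow_pos hc₀ 3)).2 (pow_le_one₀ hc₀.le hc₀1)
    have h2 : 1 ≤ Real.exp 24 := Real.one_le_exp (by norm_num)
    rw [hA]
    nlinarith
  set B : ℝ := (L : ℝ) ^ 2 + 5 * ((L : ℝ) ^ 3 * (3 : ℝ) ^ 2) with hB
  have hB0 : 0 ≤ B := by positivity
  set C : ℝ := B * A * (L : ℝ) ^ 5 with hC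
  have hL5 : 1 ≤ (L : ℝ) ^ 5 := one_le_pow₀ hL1
  have hB1 : 1 ≤ B := by
    have : (0 : ℝ) ≤ 5 * ((L : ℝ) ^ 3 * (3 : ℝ) ^ 2) := by positivity
    nlinarith
  have hAC : A ≤ C := by
    rw [hC]
    calc A = 1 * A * 1 := by ring
      _ ≤ B * A * (L : ℝ) ^ 5 := by gcongr
  have hBC : B * (L : ℝ) ^ 5 ≤ C := by
    rw [hC]
    calc B * (L : ℝ) ^ 5 = B * 1 * (L : ℝ) ^ 5 := by ring
      _ ≤ B * A * (L : ℝ) ^ 5 := by gcongr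
  have hC0 : 0 ≤ C := by positivity
  -- the rate
  set lam : ℝ := Real.sqrt (L : ℝ) / W with hlam
  have hlam0 : 0 < lam := div_pos hsqrtL0 hW0
  have hlam1 : lam ≤ 1 := (div_le_one hW0).2 (hsqrtL.trans hLW)
  have hlam2 : lam ^ 2 = (L : ℝ) / W ^ 2 := by rw [hlam, div_pow, Real.sq_sqrt hL0.le]
  have hWX : (L : ℝ) ^ 2 + 6 * (((3 + 2) * L : ℕ) : ℝ) ^ 2 = W - 1 := by rw [hW]; ring
  clear_value W A B C lam
  refine ⟨γθ, C, 1 / 4, lam, 5, hγθ, hγθ1, by norm_num, hC0, hlam0, hlam1, ?_⟩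
  intro F γ hFL hγ hγ₁ K
  subst hFL
  have hγ1 : γ ≤ 1 := hγ₁.trans hγθ1
  haveI := isProbabilityMeasure_gibbsK F ℰp hγ.le K
  -- definitional bookkeeping of the `K`-th torus
  have hPd : (F.P K).d = 3 := rfl
  have hPL : (F.P K).L = F.L := rfl
  have hcard3 : Fintype.card {q : Fin (F.P K).d × Fin (F.P K).d // q.1 < q.2} = 3 := by rw [hPd]; decide
  -- `β_h ≥ 1`
  have hβ1 : ∀ h : ℕ, 1 ≤ (γ * ((F.L : ℝ)⁻¹) ^ h)⁻¹ := by
    intro h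
    have hx : 0 < γ * ((F.L : ℝ)⁻¹) ^ h := mul_pos hγ (pow_pos (inv_pos.2 hL0) h)
    have hx1 : γ * ((F.L : ℝ)⁻¹) ^ h ≤ 1 :=
      mul_le_one₀ hγ1 (pow_nonneg (inv_nonneg.2 (Nat.cast_nonneg _)) h)
        (pow_le_one₀ (inv_nonneg.2 (Nat.cast_nonneg _)) (inv_le_one_of_one_le₀ hL1))
    exact (one_le_inv₀ hx).2 hx1
  -- the induction on the depth (the profile `b ≤ b₀` inside the predicate)
  intro j
  induction j with
  | zero =>
    intro _ b hb _hbb₀ p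
    set β := (γ * ((F.L : ℝ)⁻¹) ^ K)⁻¹ with hβdef
    set θ := θBal F.L γ b p₀ K with hθdef
    have hθ0 : 0 ≤ θ := (θBal_pos hL hγ hγ1 hb p₀ K).le
    have hβK : (F.scheme ℰp γ).β K = β := rfl
    have hset : {U : GaugeField (F.P K) 0 (Matrix.specialUnitaryGroup (Fin 2) ℂ) | θBal F.L γ b p₀ (K - 0) ≤
          dist1 (GaugeField.plaqHol (Averaging.iter (fun i => BlockAveraging.blockAvg (P := F.P K) (j := i) ℰp) 0 U) p)} =
        {U | θ ≤ dist1 (GaugeField.plaqHol U p)} := by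
      simp only [Nat.sub_zero]
      rfl
    rw [hset, gibbsK_eq, hβK]
    refine (htail (F.P K) β (hβ1 K) θ hθ0 p).trans ?_
    rw [hcard3, hPd]
    simp only [Nat.sub_zero, mul_zero, pow_zero, mul_one, zero_add, pow_one]
    -- the exponent: `β θ²/4 = p²/4`
    have hexp : β * θ ^ 2 / (2 * (2 : ℕ)) = 1 / 4 * B10.pFun b p₀ (Real.sqrt (γ * ((F.L : ℝ)⁻¹) ^ K)) ^ 2 := by
      rw [← (beta_height_succ_and_sq F hγ b p₀ K).2]
      push_cast
      ring
    rw [hexp]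
    -- the prefactor: `(√β)^9 ≤ β^5`
    have hβ0 : 0 ≤ β := zero_le_one.trans (hβ1 K)
    have hsqrt : Real.sqrt β ^ (3 * (2 ^ 2 - 1)) ≤ β ^ 5 := by
      rw [show 3 * (2 ^ 2 - 1) = 9 by norm_num]
      have hs1 : Real.sqrt β ≤ β := by
        calc Real.sqrt β ≤ Real.sqrt β * Real.sqrt β :=
              le_mul_of_one_le_right (Real.sqrt_nonneg _) (Real.one_le_sqrt.mpr (hβ1 K))
          _ = β := Real.mul_self_sqrt hβ0
      calc Real.sqrt β ^ 9 = (Real.sqrt β * Real.sqrt β) ^ 4 * Real.sqrt β := by ring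
        _ = β ^ 4 * Real.sqrt β := by rw [Real.mul_self_sqrt hβ0]
        _ ≤ β ^ 4 * β := mul_le_mul_of_nonneg_left hs1 (pow_nonneg hβ0 4)
        _ = β ^ 5 := by ring
    have hK0 : 0 ≤ 2 * Real.exp (8 * (3 : ℕ)) * (c₀ ^ 3)⁻¹ := by positivity
    calc 2 * Real.exp (8 * (3 : ℕ)) * (c₀ ^ 3)⁻¹ * Real.sqrt β ^ (3 * (2 ^ 2 - 1)) *
          Real.exp (-(1 / 4 * B10.pFun b p₀ (Real.sqrt (γ * ((F.L : ℝ)⁻¹) ^ K)) ^ 2))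
        ≤ 2 * Real.exp (8 * (3 : ℕ)) * (c₀ ^ 3)⁻¹ * β ^ 5 *
          Real.exp (-(1 / 4 * B10.pFun b p₀ (Real.sqrt (γ * ((F.L : ℝ)⁻¹) ^ K)) ^ 2)) :=
          mul_le_mul_of_nonneg_right (mul_le_mul_of_nonneg_left hsqrt hK0) (Real.exp_pos _).le
      _ = A * β ^ 5 * Real.exp (-(1 / 4 * B10.pFun b p₀ (Real.sqrt (γ * ((F.L : ℝ)⁻¹) ^ K)) ^ 2)) := by
          rw [hA]; norm_num
      _ ≤ C * β ^ 5 * Real.exp (-(1 / 4 * B10.pFun b p₀ (Real.sqrt (γ * ((F.L : ℝ)⁻¹) ^ K)) ^ 2)) := by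
          gcongr
  | succ j ih =>
    intro hjK b hb hbb₀ p
    -- heights: `h = K − (j+1)`, `K − j = h + 1`
    set h := K - (j + 1) with hh
    have hKj : K - j = h + 1 := by omega
    obtain ⟨hβsucc, hβsq⟩ := beta_height_succ_and_sq F hγ b p₀ h
    set βh := (γ * ((F.L : ℝ)⁻¹) ^ h)⁻¹ with hβhdef
    have hβh0 : 0 ≤ βh := zero_le_one.trans (hβ1 h)
    -- the threshold and the blamed size
    set θ := θBal F.L γ b p₀ h with hθdef
    have hθpos : 0 < θ := θBal_pos hL hγ hγ1 hb p₀ h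
    set a := θ / W with hadef
    have ha : 0 < a := div_pos hθpos hW0
    have haθ : a ≤ θ := div_le_self hθpos.le hW1
    -- `θ_b(h) ≤ θ_(b₀)(h) ≤ σ`: the guard of the (0.4) averaging at threshold `a`
    have hθb₀ : θ ≤ θBal F.L γ b₀ p₀ h := by
      have hc1 : b / b₀ ≤ 1 := (div_le_one hb₀).2 hbb₀
      have := θBal_mul_le hL hγ hγ1 hb₀ hc1 p₀ h
      rwa [div_mul_cancel₀ b hb₀.ne'] at this
    have hguard : (((3 + 2) * F.L : ℕ) : ℝ) ^ 2 / 4 * a < deltaSU (Fin 2) := by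
      calc (((3 + 2) * F.L : ℕ) : ℝ) ^ 2 / 4 * a
          ≤ (((3 + 2) * F.L : ℕ) : ℝ) ^ 2 / 4 * (deltaSU (Fin 2) / (((3 + 2) * F.L : ℕ) : ℝ) ^ 2) :=
            mul_le_mul_of_nonneg_left ((haθ.trans hθb₀).trans (hθ F.L hL γ hγ hγ₁ h)) (div_nonneg (sq_nonneg _) (by norm_num))
        _ = deltaSU (Fin 2) / 4 := by field_simp
        _ < deltaSU (Fin 2) := by linarith [deltaSU_pos (n := Fin 2)]
    -- RE-LABEL the blamed threshold as a profile threshold one height up: `a = θ_(b')(h+1)`, `b' = κ·b ≤ b ≤ b₀`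
    have hθ1pos : 0 < θBal F.L γ b p₀ (h + 1) := θBal_pos hL hγ hγ1 hb p₀ (h + 1)
    have hθW : θ ≤ W * θBal F.L γ b p₀ (h + 1) := by
      have hκ : W⁻¹ * Real.sqrt (F.L : ℝ) ≤ 1 := by
        rw [inv_mul_le_iff₀ hW0, mul_one]
        exact hsqrtL.trans hLW
      have := mul_θBal_le_θBal_succ hL hγ hγ1 hb.le (by linarith : (0 : ℝ) ≤ p₀) hκ h
      rwa [inv_mul_le_iff₀ hW0] at this
    set κ := θ / (W * θBal F.L γ b p₀ (h + 1)) with hκdef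
    have hκpos : 0 < κ := div_pos hθpos (mul_pos hW0 hθ1pos)
    have hκ1 : κ ≤ 1 := (div_le_one (mul_pos hW0 hθ1pos)).2 hθW
    set b' := κ * b with hb'def
    have hb' : 0 < b' := mul_pos hκpos hb
    have hb'b₀ : b' ≤ b₀ := (mul_le_of_le_one_left hb.le hκ1).trans hbb₀
    have ha_eq : θBal F.L γ b' p₀ (h + 1) = a := by
      rw [hb'def, θBal_mul, hκdef, hadef]
      field_simp
    -- EXACT height arithmetic of the re-labelled profile: `p_(b')(g_(h+1))² = λ²·p_b(g_h)²`
    have hpg' : B10.pFun b' p₀ (Real.sqrt (γ * ((F.L : ℝ)⁻¹) ^ (h + 1))) ^ 2 =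
        lam ^ 2 * B10.pFun b p₀ (Real.sqrt (γ * ((F.L : ℝ)⁻¹) ^ h)) ^ 2 := by
      rw [← (beta_height_succ_and_sq F hγ b' p₀ (h + 1)).2, ← hβsq, ha_eq, hβsucc, hlam2, hadef]
      field_simp
    -- the blamed neighbourhood of `p` at level `j`
    have hj : j + 1 ≤ (F.P K).m + (F.P K).K := by show j + 1 ≤ F.m + K; have := F.hm; omega
    obtain ⟨S, hScard, hSdom⟩ := exists_blame_finset (n := Fin 2) hj p
    rw [hPd, hPL] at hScard hSdom
    push_cast at hScard
    -- the event lies in the union of the blamed level-`j` events at threshold `a`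
    have hsub : {U : GaugeField (F.P K) 0 (Matrix.specialUnitaryGroup (Fin 2) ℂ) | θBal F.L γ b p₀ (K - (j + 1)) ≤
          dist1 (GaugeField.plaqHol (Averaging.iter (fun i => BlockAveraging.blockAvg (P := F.P K) (j := i) ℰp) (j + 1) U) p)} ⊆
        ⋃ q ∈ S, {U : GaugeField (F.P K) 0 (Matrix.specialUnitaryGroup (Fin 2) ℂ) | a ≤
          dist1 (GaugeField.plaqHol (Averaging.iter (fun i => BlockAveraging.blockAvg (P := F.P K) (j := i) ℰp) j U) q)} := by
      intro U hU
      change θ ≤ dist1 (GaugeField.plaqHol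
        (avgFun ℰp (Averaging.iter (fun i => BlockAveraging.blockAvg (P := F.P K) (j := i) ℰp) j U)) p) at hU
      by_contra hcon
      simp only [Set.mem_iUnion, Set.mem_setOf_eq, not_exists, not_le] at hcon
      have hdom := hSdom _ a ha.le hguard (fun q hq => (hcon q hq).le)
      have hlt : ((F.L : ℝ) ^ 2 + 6 * (((3 + 2) * F.L : ℕ) : ℝ) ^ 2) * a < θ := by
        have hWa : W * a = θ := by rw [hadef]; exact mul_div_cancel₀ θ hW0.ne'
        rw [hWX, sub_mul, one_mul, hWa]
        linarith
      exact absurd (hU.trans hdom) (not_le.mpr hlt)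
    -- the induction hypothesis at profile `b'` on each blamed plaquette
    have hterm : ∀ q ∈ S, (gibbsK F ℰp γ K).real {U : GaugeField (F.P K) 0 (Matrix.specialUnitaryGroup (Fin 2) ℂ) | a ≤
          dist1 (GaugeField.plaqHol (Averaging.iter (fun i => BlockAveraging.blockAvg (P := F.P K) (j := i) ℰp) j U) q)} ≤
        C ^ (j + 1) * ((F.L : ℝ) ^ 5 * βh ^ 5) *
          Real.exp (-(1 / 4 * lam ^ (2 * (j + 1)) * B10.pFun b p₀ (Real.sqrt (γ * ((F.L : ℝ)⁻¹) ^ h)) ^ 2)) := by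
      intro q _
      have hq := ih (by omega) b' hb' hb'b₀ q
      rw [hKj, ha_eq, hβsucc, mul_pow, hpg'] at hq
      refine hq.trans (le_of_eq ?_)
      ring_nf
    -- union bound
    have hE0 : 0 ≤ Real.exp (-(1 / 4 * lam ^ (2 * (j + 1)) * B10.pFun b p₀ (Real.sqrt (γ * ((F.L : ℝ)⁻¹) ^ h)) ^ 2)) :=
      (Real.exp_pos _).le
    have hL50 : 0 ≤ (F.L : ℝ) ^ 5 := pow_nonneg (Nat.cast_nonneg _) 5
    have hT0 : 0 ≤ C ^ (j + 1) * ((F.L : ℝ) ^ 5 * βh ^ 5) *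
        Real.exp (-(1 / 4 * lam ^ (2 * (j + 1)) * B10.pFun b p₀ (Real.sqrt (γ * ((F.L : ℝ)⁻¹) ^ h)) ^ 2)) :=
      mul_nonneg (mul_nonneg (pow_nonneg hC0 _) (mul_nonneg hL50 (pow_nonneg hβh0 5))) hE0
    calc (gibbsK F ℰp γ K).real _
        ≤ (gibbsK F ℰp γ K).real (⋃ q ∈ S, {U : GaugeField (F.P K) 0 (Matrix.specialUnitaryGroup (Fin 2) ℂ) | a ≤
            dist1 (GaugeField.plaqHol (Averaging.iter (fun i => BlockAveraging.blockAvg (P := F.P K) (j := i) ℰp) j U) q)}) :=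
          measureReal_mono hsub (measure_ne_top _ _)
      _ ≤ ∑ q ∈ S, (gibbsK F ℰp γ K).real {U : GaugeField (F.P K) 0 (Matrix.specialUnitaryGroup (Fin 2) ℂ) | a ≤
            dist1 (GaugeField.plaqHol (Averaging.iter (fun i => BlockAveraging.blockAvg (P := F.P K) (j := i) ℰp) j U) q)} :=
          measureReal_biUnion_finset_le S _
      _ ≤ ∑ _q ∈ S, C ^ (j + 1) * ((F.L : ℝ) ^ 5 * βh ^ 5) *
            Real.exp (-(1 / 4 * lam ^ (2 * (j + 1)) * B10.pFun b p₀ (Real.sqrt (γ * ((F.L : ℝ)⁻¹) ^ h)) ^ 2)) :=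
          Finset.sum_le_sum fun q hq => hterm q hq
      _ = S.card * (C ^ (j + 1) * ((F.L : ℝ) ^ 5 * βh ^ 5) *
            Real.exp (-(1 / 4 * lam ^ (2 * (j + 1)) * B10.pFun b p₀ (Real.sqrt (γ * ((F.L : ℝ)⁻¹) ^ h)) ^ 2))) := by
          rw [Finset.sum_const, nsmul_eq_mul]
      _ ≤ B * (C ^ (j + 1) * ((F.L : ℝ) ^ 5 * βh ^ 5) *
            Real.exp (-(1 / 4 * lam ^ (2 * (j + 1)) * B10.pFun b p₀ (Real.sqrt (γ * ((F.L : ℝ)⁻¹) ^ h)) ^ 2))) :=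
          mul_le_mul_of_nonneg_right (by rw [hB]; exact hScard) hT0
      _ = B * (F.L : ℝ) ^ 5 * (C ^ (j + 1) * βh ^ 5 *
            Real.exp (-(1 / 4 * lam ^ (2 * (j + 1)) * B10.pFun b p₀ (Real.sqrt (γ * ((F.L : ℝ)⁻¹) ^ h)) ^ 2))) := by ring
      _ ≤ C * (C ^ (j + 1) * βh ^ 5 *
            Real.exp (-(1 / 4 * lam ^ (2 * (j + 1)) * B10.pFun b p₀ (Real.sqrt (γ * ((F.L : ℝ)⁻¹) ^ h)) ^ 2))) :=
          mul_le_mul_of_nonneg_right hBC (mul_nonneg (mul_nonneg (pow_nonneg hC0 _) (pow_nonneg hβh0 5)) hE0)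
      _ = C ^ (j + 1 + 1) * βh ^ 5 *
            Real.exp (-(1 / 4 * lam ^ (2 * (j + 1)) * B10.pFun b p₀ (Real.sqrt (γ * ((F.L : ℝ)⁻¹) ^ h)) ^ 2)) := by ring

/-- ★ **The registered deep event of stmt-QuantumFields-26243 at the depth rate** (monotonicity of the Gibbs mass: the first-exit window
event «all finer levels `θ_(b₀)`-small ∧ level `j` `θ_(b₂)`-small ∧ `θ_(b₀)(K−j) ≤ |Ū^j(∂p) − 1|» is contained in the bare tail event of
the same plaquette).  Compare `stub_firstExitDeep` of 26243: identical quantifier block and event, bound `C·β^N·exp(−c·p²)` there versus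
`C^(j+1)·β^N·exp(−c·λ^(2j)·p²)` here — the rate `λ^(2j) ↦ 1` (and `C^(j+1) ↦ C`) is the single input this rung does not supply.
[cite: Balaban1985UV3, (71) p.273] -/
theorem firstExitDeep_depthRate :
    ∀ (L : ℕ) (b₀ p₀ b₂ : ℝ), 0 < b₀ → 2 < p₀ → b₀ ≤ b₂ → ∃ (γ₁ C c lam : ℝ) (N : ℕ), 0 < γ₁ ∧ γ₁ ≤ 1 ∧ 0 < c ∧ 0 ≤ C ∧
      0 < lam ∧ lam ≤ 1 ∧
      ∀ (F : T3Family) (γ : ℝ), F.L = L → 0 < γ → γ ≤ γ₁ → ∀ (K j : ℕ), 2 ≤ j → j ≤ K → ∀ p : Plaq (F.P K) j,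
        (gibbsK F ℰp γ K).real {U | (∀ k, k < j → PlaqSmall (θBal F.L γ b₀ p₀ (K - k))
            (Averaging.iter (fun i => BlockAveraging.blockAvg (P := F.P K) (j := i) ℰp) k U)) ∧
          PlaqSmall (θBal F.L γ b₂ p₀ (K - j))
            (Averaging.iter (fun i => BlockAveraging.blockAvg (P := F.P K) (j := i) ℰp) j U) ∧
          θBal F.L γ b₀ p₀ (K - j) ≤ GaugeGroup.dist1 (GaugeField.plaqHol
            (Averaging.iter (fun i => BlockAveraging.blockAvg (P := F.P K) (j := i) ℰp) j U) p)} ≤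
          C ^ (j + 1) * ((γ * ((F.L : ℝ)⁻¹) ^ (K - j))⁻¹) ^ N *
            Real.exp (-(c * lam ^ (2 * j) * B10.pFun b₀ p₀ (Real.sqrt (γ * ((F.L : ℝ)⁻¹) ^ (K - j))) ^ 2)) := by
  intro L b₀ p₀ b₂ hb₀ hp₀ _hb₂
  obtain ⟨γ₁, C, c, lam, N, hγ₁, hγ₁1, hc, hC, hlam, hlam1, h⟩ := depthRateTail L b₀ p₀ hb₀ hp₀
  refine ⟨γ₁, C, c, lam, N, hγ₁, hγ₁1, hc, hC, hlam, hlam1, ?_⟩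
  intro F γ hFL hγ hγγ₁ K j _hj2 hjK p
  haveI := isProbabilityMeasure_gibbsK F ℰp hγ.le K
  refine le_trans (measureReal_mono ?_ (measure_ne_top _ _)) (h F γ hFL hγ hγγ₁ K j hjK b₀ hb₀ le_rfl p)
  intro U hU
  exact hU.2.2

end T3

end Summit.QuantumFields.YangMills.Theorems.FirstExitWindow

end
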